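import Mathlib
import Summits.Ventures.PercRepro2.Defs
import Summits.Ventures.PercRepro2.Independence
import Summits.Ventures.PercRepro2.Harris
import Summits.Ventures.PercRepro2.Graph
import Summits.Ventures.PercRepro2.Exploration
import Summits.Ventures.PercRepro2.Events
import Summits.Ventures.PercRepro2.FourFunctions
import Summits.Ventures.PercRepro2.Induced
import Summits.Ventures.PercRepro2.Frontier
import Summits.Ventures.PercRepro2.ObsIndependence
import Summits.Ventures.PercRepro2.BHK
import Summits.Ventures.PercRepro2.BHKEvents
import Summits.Ventures.PercRepro2.OrderPreservation
import Summits.Ventures.PercRepro2.BHKAvoid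
import Summits.Ventures.PercRepro2.SameClusterAvoid
import Summits.Ventures.PercRepro2.CaseOneRegime
import Summits.Ventures.PercRepro2.CaseOnePos
import Summits.Ventures.PercRepro2.CaseOneJ11
import Summits.Ventures.PercRepro2.CaseOneRV
import Summits.Ventures.PercRepro2.CaseOnePendant
import Summits.Ventures.PercRepro2.CaseOnePendantAny

/-!
# The Q-threshold form is NECESSARY: `(ii)` on every pendant extension forces `(ii-Q)`
(blind cell PercRepro2, p1 g13; the converse half of the pendant reduction, P1-CASEONE.md §7 (a))

If `a₃` is a leaf at `v` and `(ii)(a₃)` holds for EVERY weight `t ∈ (0, 1]` of the leaf edge, then `(ii-Q)`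
holds at `v` (**`zSplitIIQ_of_leaf_at_all`**): by `iiExpr_eq_of_leaf_at` + `Dpd_leaf_at` / `Dpdo_leaf_at` +
`iiExprT_mix`, `iiExpr(a₃) = t · ((1 − t) X + t Y)` with `X = iiExprT(v; Q-pair)`, `Y = iiExprT(v; PD-pair)`
— both independent of `t`, since every event at `v, o, a₁, a₂, b` ignores the leaf edge
(`expect_update_of_ignore`, `prob_update_of_ignore`, `iiExprT_update_of_leaf_at`, `Dqo_update_of_leaf_at`,
`Dpd_update_of_leaf_at`, `Dpdo_update_of_leaf_at`); `t = 1` gives `Y ≥ 0`, and if `X < 0` the weight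
`t₀ = −X / (2 (Y − X)) ∈ (0, 1]` gives `(1 − t₀) X + t₀ Y = X / 2 < 0`. With `zSplitII_of_leaf_at` this is
the equivalence «`(ii)` on all pendant extensions of `(G′, v)` ⟺ `(ii)(v) ∧ (ii-Q)(v)`»: over all graphs,
`(ii)` is `(ii)` at the threshold `min(γ, γ_Q)`. Nothing beyond the equivalence is claimed. -/

namespace Summit.Ventures.PercRepro2

namespace CaseOne

section Invariance
variable {E : Type*} [Fintype E] [DecidableEq E] {R : Type*} [CommRing R]

/-- The expectation of an observable ignoring `e` does not depend on the weight of `e`. -/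
lemma expect_update_of_ignore (p : E → R) (e : E) (t : R) (f : Config E → R)
    (hf : ∀ ω c, f (Function.update ω e c) = f ω) :
    expect (Function.update p e t) f = expect p f := by
  rw [expect_eq_pin (Function.update p e t) f e, expect_eq_pin p f e]
  simp only [Function.update_idem, Function.update_self]
  rw [expect_update_one, expect_update_zero]
  simp only [hf]
  ring

/-- The probability of an event ignoring `e` does not depend on the weight of `e`. -/
lemma prob_update_of_ignore (p : E → R) (e : E) (t : R) (A : Set (Config E))
    (hA : ∀ ω c, A.indicator (1 : Config E → R) (Function.update ω e c) = A.indicator 1 ω) :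
    prob (Function.update p e t) A = prob p A := by
  rw [prob_eq_expect_indicator, prob_eq_expect_indicator]
  exact expect_update_of_ignore p e t _ hA

end Invariance

section LeafInvariance
variable {V : Type*} {E : Type*} [Fintype E] [DecidableEq E] {R : Type*} [CommRing R]
variable {ends : E → Sym2 V} {v a₃ : V} {e₀ : E}

/-- `P(Q)` ignores the weight of the leaf edge. -/
lemma probQ_update_of_leaf_at (p : E → R) (hl : IsLeafAt ends v a₃ e₀) (t : R) {a₁ a₂ : V}
    (h1 : a₁ ≠ a₃) (h2 : a₂ ≠ a₃) :
    prob (Function.update p e₀ t) (connEvent ends a₁ a₂)ᶜ = prob p (connEvent ends a₁ a₂)ᶜ :=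
  prob_update_of_ignore p e₀ t _ (indicator_compl_ignore
    (fun ω c => connEvent_indicator_update_of_leaf hl ω c h1 h2))

/-- `Dqo` ignores the weight of the leaf edge. -/
lemma Dqo_update_of_leaf_at (p : E → R) (hl : IsLeafAt ends v a₃ e₀) (t : R) {o a₁ a₂ : V}
    (ho : o ≠ a₃) (h1 : a₁ ≠ a₃) (h2 : a₂ ≠ a₃) :
    Dqo (Function.update p e₀ t) ends o a₁ a₂ = Dqo p ends o a₁ a₂ := by
  unfold Dqo
  exact prob_update_of_ignore p e₀ t _ (indicator_inter_ignore
    (indicator_union_ignore (fun ω c => connEvent_indicator_update_of_leaf hl ω c h1 ho)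
      (fun ω c => connEvent_indicator_update_of_leaf hl ω c h2 ho))
    (indicator_compl_ignore (fun ω c => connEvent_indicator_update_of_leaf hl ω c h1 h2)))

/-- `D(v)` ignores the weight of the leaf edge. -/
lemma Dpd_update_of_leaf_at (p : E → R) (hl : IsLeafAt ends v a₃ e₀) (t : R) {a₁ a₂ : V}
    (h1 : a₁ ≠ a₃) (h2 : a₂ ≠ a₃) :
    Dpd (Function.update p e₀ t) ends a₁ a₂ v = Dpd p ends a₁ a₂ v := by
  have hv : v ≠ a₃ := hl.ne
  unfold Dpd
  exact prob_update_of_ignore p e₀ t _ (indicator_inter_ignore (indicator_inter_ignore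
    (indicator_compl_ignore (fun ω c => connEvent_indicator_update_of_leaf hl ω c h1 hv))
    (indicator_compl_ignore (fun ω c => connEvent_indicator_update_of_leaf hl ω c h2 hv)))
    (indicator_compl_ignore (fun ω c => connEvent_indicator_update_of_leaf hl ω c h1 h2)))

/-- `D_o(v)` ignores the weight of the leaf edge. -/
lemma Dpdo_update_of_leaf_at (p : E → R) (hl : IsLeafAt ends v a₃ e₀) (t : R) {o a₁ a₂ : V}
    (ho : o ≠ a₃) (h1 : a₁ ≠ a₃) (h2 : a₂ ≠ a₃) :
    Dpdo (Function.update p e₀ t) ends o a₁ a₂ v = Dpdo p ends o a₁ a₂ v := by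
  have hv : v ≠ a₃ := hl.ne
  unfold Dpdo
  exact prob_update_of_ignore p e₀ t _ (indicator_inter_ignore (indicator_inter_ignore
    (indicator_inter_ignore
      (indicator_union_ignore (fun ω c => connEvent_indicator_update_of_leaf hl ω c h1 ho)
        (fun ω c => connEvent_indicator_update_of_leaf hl ω c h2 ho))
      (indicator_compl_ignore (fun ω c => connEvent_indicator_update_of_leaf hl ω c h1 hv)))
    (indicator_compl_ignore (fun ω c => connEvent_indicator_update_of_leaf hl ω c h2 hv)))
    (indicator_compl_ignore (fun ω c => connEvent_indicator_update_of_leaf hl ω c h1 h2)))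

/-- `iiExprT` at `v` ignores the weight of the leaf edge. -/
lemma iiExprT_update_of_leaf_at (p : E → R) (hl : IsLeafAt ends v a₃ e₀) (t : R) {o a₁ a₂ b : V}
    (ho : o ≠ a₃) (h1 : a₁ ≠ a₃) (h2 : a₂ ≠ a₃) (hb : b ≠ a₃) (c₀ c₁ : R) :
    iiExprT (Function.update p e₀ t) ends o a₁ a₂ v b c₀ c₁ = iiExprT p ends o a₁ a₂ v b c₀ c₁ := by
  have hv : v ≠ a₃ := hl.ne
  have hQ := indicator_compl_ignore (R := R)
    (fun ω c => connEvent_indicator_update_of_leaf hl ω c h1 h2)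
  have hB := fun ω c => connEvent_indicator_update_of_leaf (R := R) hl ω c h2 hb
  have hV := fun ω c => connEvent_indicator_update_of_leaf (R := R) hl ω c h1 hv
  have hO := fun ω c => connEvent_indicator_update_of_leaf (R := R) hl ω c h2 ho
  rw [iiExprT_eq, iiExprT_eq, probQ_update_of_leaf_at p hl t h1 h2,
    prob_update_of_ignore p e₀ t _ (indicator_inter_ignore (indicator_inter_ignore
      (indicator_inter_ignore hB hV) hO) hQ),
    prob_update_of_ignore p e₀ t _ (indicator_inter_ignore hB hQ),
    prob_update_of_ignore p e₀ t _ (indicator_inter_ignore (indicator_inter_ignore hV hO) hQ),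
    prob_update_of_ignore p e₀ t _ (indicator_inter_ignore (indicator_inter_ignore hB hV) hQ),
    prob_update_of_ignore p e₀ t _ (indicator_inter_ignore hV hQ)]

end LeafInvariance

section Necessity
variable {V : Type*} {E : Type*} [Fintype E] [DecidableEq E] {R : Type*} [Field R] [LinearOrder R]
  [IsStrictOrderedRing R]
variable {ends : E → Sym2 V} {v a₃ : V} {e₀ : E}

omit [LinearOrder R] [IsStrictOrderedRing R] in
/-- **`(ii)(a₃)` at the leaf weight `t` is `t · ((1 − t) · (ii-Q)(v) + t · (ii)(v))`** (cleared forms). -/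
theorem iiExpr_update_leaf_at (p : E → R) (hl : IsLeafAt ends v a₃ e₀) (t : R) (o a₁ a₂ b : V)
    (ho : o ≠ a₃) (h1 : a₁ ≠ a₃) (h2 : a₂ ≠ a₃) (hb : b ≠ a₃) :
    iiExpr (Function.update p e₀ t) ends o a₁ a₂ a₃ b =
      t * ((1 - t) * iiExprT p ends o a₁ a₂ v b (Dqo p ends o a₁ a₂) (prob p (connEvent ends a₁ a₂)ᶜ) +
        t * iiExpr p ends o a₁ a₂ v b) := by
  rw [iiExpr_eq_of_leaf_at (Function.update p e₀ t) hl o a₁ a₂ b ho h1 h2 hb,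
    Dpd_leaf_at (Function.update p e₀ t) hl a₁ a₂ h1 h2,
    Dpdo_leaf_at (Function.update p e₀ t) hl o a₁ a₂ ho h1 h2, Function.update_self, iiExprT_mix,
    iiExprT_update_of_leaf_at p hl t ho h1 h2 hb, iiExprT_update_of_leaf_at p hl t ho h1 h2 hb,
    probQ_update_of_leaf_at p hl t h1 h2, Dqo_update_of_leaf_at p hl t ho h1 h2,
    Dpd_update_of_leaf_at p hl t h1 h2, Dpdo_update_of_leaf_at p hl t ho h1 h2, iiExpr_eq_iiExprT]

/-- **`(ii-Q)` is necessary**: if `(ii)(a₃)` holds for every weight `t ∈ (0, 1]` of the leaf edge at `v`,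
then `(ii-Q)(v)` holds. -/
theorem zSplitIIQ_of_leaf_at_all (p : E → R) (hl : IsLeafAt ends v a₃ e₀) (o a₁ a₂ b : V)
    (ho : o ≠ a₃) (h1 : a₁ ≠ a₃) (h2 : a₂ ≠ a₃) (hb : b ≠ a₃)
    (h : ∀ t : R, 0 < t → t ≤ 1 → ZSplitII (Function.update p e₀ t) ends o a₁ a₂ a₃ b) :
    ZSplitIIQ p ends o a₁ a₂ v b := by
  unfold ZSplitIIQ
  set X := iiExprT p ends o a₁ a₂ v b (Dqo p ends o a₁ a₂) (prob p (connEvent ends a₁ a₂)ᶜ) with hX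
  set Y := iiExpr p ends o a₁ a₂ v b with hY
  have key : ∀ t : R, 0 < t → t ≤ 1 → 0 ≤ (1 - t) * X + t * Y := by
    intro t ht0 ht1
    have := h t ht0 ht1
    unfold ZSplitII at this
    rw [iiExpr_update_leaf_at p hl t o a₁ a₂ b ho h1 h2 hb] at this
    exact nonneg_of_mul_nonneg_right (by linarith) ht0
  have hY0 : 0 ≤ Y := by
    have := key 1 one_pos le_rfl
    linarith
  by_contra hX0
  have hX0 : X < 0 := lt_of_not_ge hX0
  -- `t₀ = −X / (2 (Y − X)) ∈ (0, 1]` gives `(1 − t₀) X + t₀ Y = X / 2 < 0`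
  have hYX : 0 < Y - X := by linarith
  set t₀ : R := -X / (2 * (Y - X)) with ht₀
  have ht0 : 0 < t₀ := by
    rw [ht₀]
    exact div_pos (by linarith) (by linarith)
  have ht1 : t₀ ≤ 1 := by
    rw [ht₀, div_le_one (by linarith)]
    linarith
  have hval : (1 - t₀) * X + t₀ * Y = X / 2 := by
    rw [ht₀]
    field_simp
    ring
  have := key t₀ ht0 ht1
  rw [hval] at this
  linarith

end Necessity

end CaseOne

end Summit.Ventures.PercRepro2
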